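import Literature.AlgebraicGeometry.Frobenioids.Prop25SubSplitting
import HarnessLib

/-!
# [FrdI] Proposition 2.5 (iii), sub-DAG row P25-L03′ — `Ψ(β) := β₀ · β₁^d` on `O^▷(A)`: discharge of
# `FrdI.P25.SplitPowEndo`

Mochizuki, *The geometry of Frobenioids I: the general theory*, Kyushu J. Math. **62** (2008)
293–400, §2, proof of Proposition 2.5 (iii), p. 49 l. 37 – p. 50 l. 2 and p. 50 ll. 11–13
[cite: MochizukiFrdI2008, Prop. 2.5(iii) p.49]: "Now we set `Ψ(β) := β₀ · β₁^d` … [the expression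
`β₁^d` makes sense …]"; "the elementary computation `Ψ(β^{d′}) = … = Ψ(β)^{d′}`".
PROOF-ONLY companion of `Prop25Sub.lean` (row P25-L03′ `SplitPowEndo`, holder/typer abc-iut-L1-t2):
from the unique splitting `β = β₀ · β₁` at an arbitrary object (`splittingAtAnyObject_holds`,
`Prop25SubSplitting.lean`) and the commutativity of `O^▷(A)` (Rem. 1.3.1), `β ↦ β₀ · β₁^d` is the unique
monoid endomorphism of `O^▷(A)` fixing `O^×(A)` and raising the `τ`-part to the `d`-th power.
No new definitions (the endomorphism is produced inside the proof).
-/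

namespace Literature.AlgebraicGeometry.Frobenioids

open CategoryTheory Opposite

namespace FrdI.P25

open PreFrobenioid

universe w v v' u u'

variable {D : Type u} [Category.{v} D] {Φ : Dᵒᵖ ⥤ CommMonCat.{w}}
  {C : Type u'} [Category.{v'} C] {F : C ⥤ ElemFrobenioid Φ}

/-- **Row P25-L03′ `SplitPowEndo` DISCHARGED**: for an isotropic hull `h : A → A^istr` there is a unique
monoid endomorphism `Ψ` of `O^▷(A)` with `Ψ = id` on `O^×(A)` and `Ψ(β₁) = β₁^d` for `β₁` in `τ` via
`h`; it is `β = β₀ · β₁ ↦ β₀ · β₁^d`. [cite: MochizukiFrdI2008, Prop. 2.5(iii) p.49] -/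
theorem splitPowEndo_holds (τ : CharacteristicSplitting F) (d : ℕ+) : SplitPowEndo F τ d := by
  intro hS A A' h hh
  have hF := hS.isFrobenioid
  have hsplit := splittingAtAnyObject_holds (F := F) τ hS h hh
  choose p hp huniq using hsplit
  -- the two components of the splitting of `x ∈ O^▷(A)`, as elements of `O^▷(A)`
  let U : endSubmonoid F A → endSubmonoid F A := fun x => ⟨(p x.1 x.2).1.hom, (hp x.1 x.2).1⟩
  let B : endSubmonoid F A → endSubmonoid F A := fun x => ⟨(p x.1 x.2).2, (hp x.1 x.2).2.1⟩
  have hUB : ∀ x : endSubmonoid F A, x = U x * B x := fun x =>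
    Subtype.ext ((hp x.1 x.2).2.2.2.trans rfl)
  have hBtau : ∀ x : endSubmonoid F A, InTauVia τ h (B x).1 := fun x => (hp x.1 x.2).2.2.1
  -- uniqueness of the splitting, in the form used below
  have hkey : ∀ (x : endSubmonoid F A) (u : Aut A) (hu : u ∈ unitsSubgroup F A) (b : endSubmonoid F A),
      InTauVia τ h b.1 → x = ⟨u.hom, hu⟩ * b → U x = ⟨u.hom, hu⟩ ∧ B x = b := by
    intro x u hu b hb hx
    have e : (u, b.1) = p x.1 x.2 :=
      huniq x.1 x.2 (u, b.1) ⟨hu, b.2, hb, (congrArg Subtype.val hx).trans rfl⟩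
    refine ⟨Subtype.ext ?_, Subtype.ext ?_⟩
    · show (p x.1 x.2).1.hom = u.hom
      rw [← e]
    · show (p x.1 x.2).2 = b.1
      rw [← e]
  -- the splitting is multiplicative
  have hone : U 1 = 1 ∧ B 1 = 1 := by
    have := hkey 1 1 (unitsSubgroup F A).one_mem 1 ⟨𝟙 A', (τ.τ A').one_mem, by simp⟩
      (by rw [mul_one]; rfl)
    exact this
  have hInTau_mul : ∀ b b' : endSubmonoid F A, InTauVia τ h b.1 → InTauVia τ h b'.1 →
      InTauVia τ h (b * b').1 := by
    rintro b b' ⟨t, ht, hbt⟩ ⟨t', ht', hbt'⟩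
    refine ⟨t' ≫ t, (τ.τ A').mul_mem ht ht', ?_⟩
    show h ≫ t' ≫ t = ((b'.1 : A ⟶ A) ≫ b.1) ≫ h
    rw [← Category.assoc, hbt', Category.assoc, hbt, Category.assoc]
  have hmul : ∀ x y : endSubmonoid F A, U (x * y) = U x * U y ∧ B (x * y) = B x * B y := by
    intro x y
    have hu : (p x.1 x.2).1 * (p y.1 y.2).1 ∈ unitsSubgroup F A :=
      (unitsSubgroup F A).mul_mem (hp x.1 x.2).1 (hp y.1 y.2).1
    have h1 := hkey (x * y) ((p x.1 x.2).1 * (p y.1 y.2).1) hu (B x * B y)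
      (hInTau_mul _ _ (hBtau x) (hBtau y)) (by
        have e : (⟨((p x.1 x.2).1 * (p y.1 y.2).1).hom, hu⟩ : endSubmonoid F A) = U x * U y := rfl
        rw [e]
        calc x * y = (U x * B x) * (U y * B y) := by rw [← hUB x, ← hUB y]
          _ = U x * U y * (B x * B y) := by
            rw [mul_assoc, mul_assoc, ← mul_assoc (B x), endSubmonoid_comm F hF (B x) (U y),
              mul_assoc])
    exact ⟨h1.1, h1.2⟩
  -- the endomorphism
  let Ψ : endSubmonoid F A →* endSubmonoid F A :=
    { toFun := fun x => U x * B x ^ (d : ℕ)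
      map_one' := by
        show U 1 * B 1 ^ (d : ℕ) = 1
        rw [hone.1, hone.2, one_pow, one_mul]
      map_mul' := fun x y => by
        show U (x * y) * B (x * y) ^ (d : ℕ) = (U x * B x ^ (d : ℕ)) * (U y * B y ^ (d : ℕ))
        have hc : Commute (B x) (B y) := endSubmonoid_comm F hF (B x) (B y)
        rw [(hmul x y).1, (hmul x y).2, hc.mul_pow]
        calc U x * U y * (B x ^ (d : ℕ) * B y ^ (d : ℕ))
            = U x * ((U y * B x ^ (d : ℕ)) * B y ^ (d : ℕ)) := by simp only [mul_assoc]
          _ = U x * ((B x ^ (d : ℕ) * U y) * B y ^ (d : ℕ)) := by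
              rw [endSubmonoid_comm F hF (U y) (B x ^ (d : ℕ))]
          _ = U x * B x ^ (d : ℕ) * (U y * B y ^ (d : ℕ)) := by simp only [mul_assoc] }
  have hΨU : ∀ (u : Aut A) (hu : u ∈ unitsSubgroup F A), Ψ ⟨u.hom, hu⟩ = ⟨u.hom, hu⟩ := by
    intro u hu
    have h1 := hkey ⟨u.hom, hu⟩ u hu 1 ⟨𝟙 A', (τ.τ A').one_mem, by simp⟩ (by rw [mul_one])
    show U _ * B _ ^ (d : ℕ) = _
    rw [h1.1, h1.2, one_pow, mul_one]
  have hΨB : ∀ β : endSubmonoid F A, InTauVia τ h β.1 → Ψ β = β ^ (d : ℕ) := by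
    intro β hβ
    have h1 := hkey β 1 (unitsSubgroup F A).one_mem β hβ (by
      apply Subtype.ext
      change β.1 = β.1 ≫ (1 : Aut A).hom
      exact (Category.comp_id _).symm)
    show U β * B β ^ (d : ℕ) = _
    rw [h1.1, h1.2]
    have e : (⟨(1 : Aut A).hom, (unitsSubgroup F A).one_mem⟩ : endSubmonoid F A) = 1 := rfl
    rw [e, one_mul]
  refine ⟨Ψ, ⟨hΨU, hΨB⟩, ?_⟩
  -- uniqueness
  rintro Ψ' ⟨hΨ'U, hΨ'B⟩
  ext x : 2
  have e : Ψ' x = Ψ x := by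
    rw [hUB x, map_mul, map_mul, hΨ'U _ (hp x.1 x.2).1, hΨU _ (hp x.1 x.2).1,
      hΨ'B _ (hBtau x), hΨB _ (hBtau x)]
  exact congrArg Subtype.val e

end FrdI.P25

end Literature.AlgebraicGeometry.Frobenioids
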